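import Summits.ResolutionOfSingularities.ResolutionOfSingularities.Theorems.SectionAscentFibrewiseClosedPointsTraceIdealAssembly
import Literature.AlgebraicGeometry.Resolution.PatchingMorphismStep
import Literature.AlgebraicGeometry.Resolution.QuasiExcellentSchemes
import Literature.AlgebraicGeometry.Resolution.AlterationsDimension
import Literature.AlgebraicGeometry.Resolution.ExcellentRingsFieldProofs
import Literature.AlgebraicGeometry.Resolution.AffineBlowupIntegral
import Literature.AlgebraicGeometry.Resolution.ArithmeticalThreefoldsBlowupForm
import HarnessLib

/-!
# `FibrewiseClosedPoints` — support lemmas: the crux's level `d = 3` (affine threefolds) from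
Cossart–Piltant's theorems

Helper lemmas for crux `stmt-ResolutionOfSingularities-15960`
(`Summit.ResolutionOfSingularities.ResolutionOfSingularities.Theses.SectionAscent.FibrewiseClosedPoints`),
closing the kernel side of the re-centering / trace-ideal-untwist mechanism
(`Cruxes/FibrewiseClosedPoints/ExactCentre.md`; `…TraceIdeal*.lean`), lead c2, 2026-08-17:
**the `OneShot` body for three-dimensional affine domains over any field**, conditional on exactly
two results in print —

1. the `J`-data: Cossart–Piltant 2019, Thm. 1.1 (i)(ii) with its last sentence ("if a finite
   affine covering is specified, one may take `π⁻¹(𝒰ᵢ) → 𝒰ᵢ` projective" — for the affine `X`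
   itself) combined with Liu 2002, Thm. 8.1.24 (a projective birational morphism onto an integral
   scheme quasi-projective over an affine Noetherian scheme is a blowing up): a non-zero `J` with
   `Bl_J(Spec A)` regular and `Bl_J → Spec A` an isomorphism over `Reg(Spec A)` — the Literature fact
   `CossartPiltant2019AffineOneBlowup` (`ArithmeticalThreefoldsBlowupForm.lean`; also taken as a bare hypothesis `hCP`);
2. the tree's named fact `CossartPiltant2019Principalization` (CP 2019, Prop. 4.3 of arXiv v1).

* `isPrincipal_map_of_isIso_morphismRestrict` — an isomorphism locus of `Bl_J → Spec A` is a
  principal locus of `J` (ExactCentre.md §3 Step 2), converting CP's clause (ii) into the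
  hypothesis `hprin` of the untwist.
* `affineBlowup_isNoetherian_isExcellent_dim` — `Bl_J(Spec A)` is Noetherian, excellent and
  three-dimensional for `A` a domain of finite type and dimension three over a field (Stacks 07QW,
  tree `Stacks07QW_field_holds`; dimension read on the dense open `π⁻¹D(a) ≅ D(a)`).
* `oneShotBody_three_of_facts` — **the level-`3` theorem from the two named facts** (Literature
  `CossartPiltant2019AffineOneBlowup`, `CossartPiltant2019Principalization`), with its registered form.
* `oneShot_level_four_of_facts` — **`OneShot p 3 → OneShot p 4` (the crux's level `d = 3` in the
  route's own shape) from the two named facts**, with its registered form.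
* `oneShotBody_of_ringKrullDim_eq_three` — **the level-`3` theorem** (the case `dim A = 3`; the
  crux's hypothesis `OneShot p 3` covers `dim A < 3`), and its registered explicit form
  `oneShotBody_of_ringKrullDim_eq_three_explicit`.

So the record "first open instance of the crux: d = 3" (Disproof.lean, CruxAttack.md) is superseded:
level `3` is in print (and, modulo the two named facts, in the kernel); the first open level is
`d = 4` — resolution of singularities of affine fourfolds.

## Sources
* V. Cossart, O. Piltant, J. Algebra 529 (2019) = arXiv:1412.0868: Thm 1.1 and the sentence after
  it, p. 3 (the remark "not even known … even when 𝒳 is affine", answered here), Prop. 4.3 (v1).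
  [CossartPiltant2019]
* Q. Liu, *Algebraic Geometry and Arithmetic Curves* (2002), Thm. 8.1.24. [Liu2002]
* U. Görtz, T. Wedhorn, *Algebraic Geometry I* (2020), Prop. 13.91, Thm. 5.22 (3). [GortzWedhorn2020]
* J. Kollár, J. Witaszek, arXiv:2102.03162 (the normal case). [KollarWitaszek2021]
-/

noncomputable section

set_option linter.dupNamespace false

open AlgebraicGeometry CategoryTheory Literature.AlgebraicGeometry.Resolution

namespace Summit.ResolutionOfSingularities.ResolutionOfSingularities.Theorems.SectionAscent.TraceIdeal

universe u

variable {A : Type u} [CommRing A]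

/-- **An isomorphism locus of `Bl_J → Spec A` is a principal locus of `J`** (ExactCentre.md §3
Step 2): if the blowing up is an isomorphism over the open `U ∋ 𝔭`, then `J A_𝔭` is principal —
over `U` the exceptional ideal `J~·𝒪` is effective Cartier and is `J~|_U` itself. This converts the
"isomorphism over `Reg`" clause of Cossart–Piltant's Thm 1.1 (ii) into the hypothesis `hprin` of the
untwist. [cite: GortzWedhorn2020, Prop. 13.91] -/
theorem isPrincipal_map_of_isIso_morphismRestrict [IsNoetherianRing A] (J : Ideal A)
    (U : (Spec (.of A)).Opens) [IsIso (affineBlowup.π J ∣_ U)] (𝔭 : Spec (.of A)) (h𝔭 : 𝔭 ∈ U) :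
    (J.map (algebraMap A (Localization.AtPrime 𝔭.asIdeal))).IsPrincipal := by
  have hK : IsEffectiveCartier ((affineBlowup.idealSheaf J).comap U.ι) := by
    have h1 := ((affineBlowup.isBlowup J).restrict U).isEffectiveCartier
    have h2 := h1.comap_iso (asIso (affineBlowup.π J ∣_ U)).symm
    rwa [← Scheme.IdealSheafData.comap_comp, Iso.symm_hom, asIso_inv, IsIso.inv_hom_id,
      Scheme.IdealSheafData.comap_id] at h2
  have hlp : IsLocallyPrincipalAt (affineBlowup.idealSheaf J) 𝔭 :=
    isLocallyPrincipalAt_of_comap_isOpenImmersion U.ι (affineBlowup.idealSheaf J) (y := ⟨𝔭, h𝔭⟩)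
      (hK.isLocallyPrincipal _)
  obtain ⟨g, hg⟩ := hlp.isPrincipal_stalkIdeal
  letI : Algebra A ((Spec (.of A)).presheaf.stalk 𝔭) := StructureSheaf.stalkAlgebra A 𝔭
  haveI : IsLocalization.AtPrime ((Spec (.of A)).presheaf.stalk 𝔭) 𝔭.asIdeal :=
    StructureSheaf.IsLocalization.to_stalk A 𝔭
  have hst : stalkIdeal (affineBlowup.idealSheaf J) 𝔭 =
      J.map (algebraMap A ((Spec (.of A)).presheaf.stalk 𝔭)) := by
    rw [affineBlowup.idealSheaf, stalkIdeal_eq_map_germ _ ⟨⊤, isAffineOpen_top _⟩ (Set.mem_univ _),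
      Scheme.IdealSheafData.ofIdealTop_ideal, Ideal.map_map, Ideal.map_map]
    congr 1
  let e := IsLocalization.algEquiv 𝔭.asIdeal.primeCompl ((Spec (.of A)).presheaf.stalk 𝔭)
    (Localization.AtPrime 𝔭.asIdeal)
  have hcomp : (e.toAlgHom.toRingHom).comp (algebraMap A ((Spec (.of A)).presheaf.stalk 𝔭)) =
      algebraMap A (Localization.AtPrime 𝔭.asIdeal) := by
    ext r
    exact e.commutes r
  have he : J.map (algebraMap A (Localization.AtPrime 𝔭.asIdeal)) =
      (J.map (algebraMap A ((Spec (.of A)).presheaf.stalk 𝔭))).map e.toAlgHom.toRingHom := by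
    rw [Ideal.map_map, hcomp]
  refine ⟨⟨e g, ?_⟩⟩
  rw [he, ← hst]
  change Ideal.map _ (stalkIdeal (affineBlowup.idealSheaf J) 𝔭) = _
  rw [hg, Ideal.submodule_span_eq, Ideal.map_span, Set.image_singleton]
  rfl


section DimThree

open Literature.AlgebraicGeometry.Resolution in
/-- **`Bl_J(Spec A)` satisfies the hypotheses of Cossart–Piltant principalization** when `A` is a
domain of finite type and dimension three over a field and `J ≠ 0`: it is Noetherian (proper over
`Spec A`, of finite type over `K`), excellent (finite type over a field, Stacks 07QW, tree
`Stacks07QW_field_holds`) and three-dimensional (it contains the dense open `π⁻¹D(a) ≅ D(a)`,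
`0 ≠ a ∈ J`, and dimension of integral schemes of finite type over a field is read on dense opens).
[cite: GortzWedhorn2020, Thm. 5.22 (3)] -/
theorem affineBlowup_isNoetherian_isExcellent_dim (K : Type u) {A : Type u} [Field K] [CommRing A]
    [IsDomain A]
    [Algebra K A] [Algebra.FiniteType K A] (J : Ideal A) (hJ : J ≠ ⊥) (hdim : ringKrullDim A = 3) :
    IsNoetherian (affineBlowup J) ∧ Scheme.IsExcellent (affineBlowup J) ∧
      topologicalKrullDim (affineBlowup J) = 3 := by
  haveI : IsNoetherianRing A := Algebra.FiniteType.isNoetherianRing K A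
  haveI : IsIntegral (affineBlowup J) := affineBlowup.isIntegral hJ
  let g : Spec (.of A) ⟶ Spec (.of K) := Spec.map (CommRingCat.ofHom (algebraMap K A))
  haveI : LocallyOfFiniteType g :=
    (HasRingHomProperty.Spec_iff (P := @LocallyOfFiniteType)).mpr
      (RingHom.finiteType_algebraMap.mpr ‹Algebra.FiniteType K A›)
  let f : affineBlowup J ⟶ Spec (.of K) := affineBlowup.π J ≫ g
  haveI : LocallyOfFiniteType f := inferInstance
  haveI : QuasiCompact f := inferInstance
  refine ⟨Scheme.isNoetherian_of_finiteType_over_field f,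
    Scheme.isExcellent_of_locallyOfFiniteType Stacks07QW_field_holds f, ?_⟩
  -- dimension: through the open `Spec A[1/a] → Bl_J`, `→ Spec A`
  obtain ⟨a, haJ, ha0⟩ := J.ne_bot_iff.mp hJ
  haveI : IsDomain (Localization.Away a) :=
    IsLocalization.isDomain_localization (powers_le_nonZeroDivisors_of_noZeroDivisors ha0)
  haveI : Nonempty (Spec (.of (Localization.Away a))) :=
    ⟨(⟨⊥, Ideal.isPrime_bot⟩ : PrimeSpectrum (Localization.Away a))⟩
  have h1 := topologicalKrullDim_eq_of_isOpenImmersion f (affineBlowup.awayι a haJ)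
  have h2 := topologicalKrullDim_eq_of_isOpenImmersion g (affineBlowup.awayι a haJ ≫ affineBlowup.π J)
  rw [← h1, h2]
  change topologicalKrullDim (PrimeSpectrum A) = 3
  rw [PrimeSpectrum.topologicalKrullDim_eq_ringKrullDim, hdim]

/-- **`OneShot` in dimension three from the named facts** (crux level `d = 3`, the case
`dim A = 3`; `dim A < 3` is the hypothesis `OneShot p 3` of the crux): given the `J`-data
(Cossart–Piltant Thm 1.1 for the affine `Spec A` with Liu 8.1.24: `Bl_J` regular and an
isomorphism over `Reg`) and `CossartPiltant2019Principalization`, every three-dimensional domain of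
finite type over a field has a non-zero ideal `I` with `Bl_I` regular and `V(I) = Sing` exactly.
[cite: CossartPiltant2019, Thm. 1.1 and Prop. 4.4 (arXiv v1: Prop. 4.3)] -/
theorem oneShotBody_of_ringKrullDim_eq_three
    (hCP : ∀ (K : Type u) [Field K] (A : Type u) [CommRing A] [IsDomain A] [Algebra K A]
      [Algebra.FiniteType K A], ringKrullDim A ≤ 3 → ∃ J : Ideal A, J ≠ ⊥ ∧
        Scheme.IsRegular (affineBlowup J) ∧ ∃ U : (Spec (.of A)).Opens,
          (U : Set (Spec (.of A))) = {x | IsRegularLocalRing (Localization.AtPrime x.asIdeal)} ∧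
          IsIso (affineBlowup.π J ∣_ U))
    (hP : CossartPiltant2019Principalization.{u})
    (K : Type u) [Field K] (A : Type u) [CommRing A] [IsDomain A] [Algebra K A]
    [Algebra.FiniteType K A] (hdim : ringKrullDim A = 3) :
    ∃ I : Ideal A, I ≠ ⊥ ∧ Scheme.IsRegular (affineBlowup I) ∧
      ∀ 𝔭 : PrimeSpectrum A, I ≤ 𝔭.asIdeal ↔ ¬ IsRegularLocalRing (Localization.AtPrime 𝔭.asIdeal) := by
  haveI : IsNoetherianRing A := Algebra.FiniteType.isNoetherianRing K A
  obtain ⟨J, hJ, hreg, U, hU, hiso⟩ := hCP K A hdim.le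
  obtain ⟨a, haJ, ha0⟩ := J.ne_bot_iff.mp hJ
  haveI := hiso
  have hprin : ∀ 𝔭 : PrimeSpectrum A, IsRegularLocalRing (Localization.AtPrime 𝔭.asIdeal) →
      (J.map (algebraMap A (Localization.AtPrime 𝔭.asIdeal))).IsPrincipal := fun 𝔭 h𝔭 =>
    isPrincipal_map_of_isIso_morphismRestrict J U 𝔭 (by
      rw [← SetLike.mem_coe, hU]; exact h𝔭)
  obtain ⟨hN, hexc, hdim'⟩ := affineBlowup_isNoetherian_isExcellent_dim K J hJ hdim
  haveI := hN
  exact exists_oneShot_of_principalization hP J haJ ha0 hreg hprin hexc hdim'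

end DimThree

/-! ## From the named facts -/

/-- **Crux level `d = 3`, case `dim A = 3`, from the two named facts**: the Literature fact
`CossartPiltant2019AffineOneBlowup` (CP 2019 Thm 1.1 for the affine `Spec A` ⊕ Liu 8.1.24:
`Bl_J` regular and an isomorphism over `Reg`) and `CossartPiltant2019Principalization` (CP 2019
Prop. 4.3 of v1) give the `OneShot` body for every three-dimensional affine domain over any field —
a blowing up `Bl_I(Spec A)`, regular, with `V(I) = Sing(Spec A)` EXACTLY (Cossart–Piltant's remark
p. 3, affine case). [cite: CossartPiltant2019, Thm. 1.1, p. 3 and Prop. 4.4 (arXiv v1: Prop. 4.3)] -/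
theorem oneShotBody_three_of_facts (h : CossartPiltant2019AffineOneBlowup.{u})
    (hP : CossartPiltant2019Principalization.{u}) (K : Type u) [Field K] (A : Type u) [CommRing A]
    [IsDomain A] [Algebra K A] [Algebra.FiniteType K A] (hdim : ringKrullDim A = 3) :
    ∃ I : Ideal A, I ≠ ⊥ ∧ Scheme.IsRegular (affineBlowup I) ∧
      ∀ 𝔭 : PrimeSpectrum A, I ≤ 𝔭.asIdeal ↔ ¬ IsRegularLocalRing (Localization.AtPrime 𝔭.asIdeal) :=
  oneShotBody_of_ringKrullDim_eq_three (fun K _ A _ _ _ _ h3 => h K A h3) hP K A hdim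

/-- `x < n + 1` in `WithBot ℕ∞` splits as `x < n` or `x = n`. [folklore] -/
theorem WithBot.lt_coe_nat_succ_iff' (x : WithBot ℕ∞) (n : ℕ)
    (hx : x < ((n + 1 : ℕ) : WithBot ℕ∞)) : x < ((n : ℕ) : WithBot ℕ∞) ∨ x = ((n : ℕ) : WithBot ℕ∞) := by
  induction x using WithBot.recBotCoe with
  | bot => exact Or.inl (by exact_mod_cast WithBot.bot_lt_coe (n : ℕ∞))
  | coe y =>
    have hx' : y < ((n + 1 : ℕ) : ℕ∞) := by exact_mod_cast hx
    suffices h : y < (n : ℕ∞) ∨ y = (n : ℕ∞) by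
      rcases h with h | h
      · exact Or.inl (by exact_mod_cast h)
      · exact Or.inr (by exact_mod_cast h)
    induction y using ENat.recTopCoe with
    | top => exact absurd hx' (not_lt_of_ge le_top)
    | coe m =>
      have hm : m < n + 1 := by exact_mod_cast hx'
      rcases Nat.lt_succ_iff_lt_or_eq.mp hm with h | h
      · exact Or.inl (by exact_mod_cast h)
      · exact Or.inr (by exact_mod_cast h)

/-- **Crux level `d = 3` in the route's own shape, from the two named facts: `OneShot p 3 → OneShot p 4`**
(bodies verbatim the route's `let OneShot`; the hypothesis `Almost p 4` of `FibrewiseClosedPoints`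
is not needed): dimension `< 3` is the hypothesis, dimension `= 3` is
`oneShotBody_three_of_facts`. [cite: CossartPiltant2019, Thm. 1.1 and Prop. 4.4 (arXiv v1: Prop. 4.3)] -/
theorem oneShot_level_four_of_facts (h : CossartPiltant2019AffineOneBlowup.{0})
    (hP : CossartPiltant2019Principalization.{0}) (p : ℕ)
    (h3 : ∀ (K : Type) [Field K] [CharP K p] (A : Type) [CommRing A] [IsDomain A] [Algebra K A]
      [Algebra.FiniteType K A], ringKrullDim A < ((3 : ℕ) : WithBot ℕ∞) →
        ∃ I : Ideal A, I ≠ ⊥ ∧ Scheme.IsRegular (affineBlowup I) ∧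
          ∀ 𝔭 : PrimeSpectrum A, I ≤ 𝔭.asIdeal ↔ ¬ IsRegularLocalRing (Localization.AtPrime 𝔭.asIdeal))
    (K : Type) [Field K] [CharP K p] (A : Type) [CommRing A] [IsDomain A] [Algebra K A]
    [Algebra.FiniteType K A] (hA : ringKrullDim A < ((3 + 1 : ℕ) : WithBot ℕ∞)) :
    ∃ I : Ideal A, I ≠ ⊥ ∧ Scheme.IsRegular (affineBlowup I) ∧
      ∀ 𝔭 : PrimeSpectrum A, I ≤ 𝔭.asIdeal ↔ ¬ IsRegularLocalRing (Localization.AtPrime 𝔭.asIdeal) := by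
  rcases WithBot.lt_coe_nat_succ_iff' (ringKrullDim A) 3 hA with hlt | heq
  · exact h3 K A hlt
  · exact oneShotBody_three_of_facts h hP K A (by exact_mod_cast heq)

/-! ## Registered form (universe `0`, explicit binders) -/

/-- Registered explicit form of `oneShotBody_of_ringKrullDim_eq_three` (universe `0`).
[cite: CossartPiltant2019, Thm. 1.1 and Prop. 4.4 (arXiv v1: Prop. 4.3)] -/
theorem oneShotBody_of_ringKrullDim_eq_three_explicit (hCP : ∀ (K : Type) [Field K] (A : Type)
    [CommRing A] [IsDomain A] [Algebra K A]
    [Algebra.FiniteType K A], ringKrullDim A ≤ 3 → ∃ J : Ideal A, J ≠ ⊥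
      ∧ Literature.AlgebraicGeometry.Resolution.Scheme.IsRegular
    (Literature.AlgebraicGeometry.Resolution.affineBlowup J) ∧ ∃ U : (AlgebraicGeometry.Spec
    (CommRingCat.of A)).Opens, (U : Set (AlgebraicGeometry.Spec (CommRingCat.of A))) =
    {x | IsRegularLocalRing (Localization.AtPrime x.asIdeal)} ∧ CategoryTheory.IsIso
    (Literature.AlgebraicGeometry.Resolution.affineBlowup.π J ∣_ U))
    (hP : Literature.AlgebraicGeometry.Resolution.CossartPiltant2019Principalization.{0}) (K : Type)
    [Field K] (A : Type) [CommRing A] [IsDomain A] [Algebra K A] [Algebra.FiniteType K A]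
    (hdim : ringKrullDim A = 3) : ∃ I : Ideal A, I ≠ ⊥
      ∧ Literature.AlgebraicGeometry.Resolution.Scheme.IsRegular
    (Literature.AlgebraicGeometry.Resolution.affineBlowup I)
      ∧ ∀ 𝔭 : PrimeSpectrum A, I ≤ 𝔭.asIdeal ↔ ¬ IsRegularLocalRing
    (Localization.AtPrime 𝔭.asIdeal) :=
  oneShotBody_of_ringKrullDim_eq_three hCP hP K A hdim

/-- Registered explicit form of `oneShotBody_three_of_facts` (universe `0`): crux level `d = 3`
modulo the two named facts in print. [cite: CossartPiltant2019, Thm. 1.1 and Prop. 4.4 (arXiv v1: Prop. 4.3)] -/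
theorem oneShotBody_three_of_facts_explicit
    (h : Literature.AlgebraicGeometry.Resolution.CossartPiltant2019AffineOneBlowup.{0})
    (hP : Literature.AlgebraicGeometry.Resolution.CossartPiltant2019Principalization.{0}) (K : Type)
    [Field K] (A : Type) [CommRing A] [IsDomain A] [Algebra K A] [Algebra.FiniteType K A]
    (hdim : ringKrullDim A = 3) : ∃ I : Ideal A, I ≠ ⊥
      ∧ Literature.AlgebraicGeometry.Resolution.Scheme.IsRegular
    (Literature.AlgebraicGeometry.Resolution.affineBlowup I)
      ∧ ∀ 𝔭 : PrimeSpectrum A, I ≤ 𝔭.asIdeal ↔ ¬ IsRegularLocalRing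
    (Localization.AtPrime 𝔭.asIdeal) :=
  oneShotBody_three_of_facts h hP K A hdim

/-- Registered explicit form of `oneShot_level_four_of_facts` (universe `0`): the crux's level
`d = 3`, `OneShot p 3 → OneShot p 4`, modulo the two named facts in print.
[cite: CossartPiltant2019, Thm. 1.1 and Prop. 4.4 (arXiv v1: Prop. 4.3)] -/
theorem oneShot_level_four_of_facts_explicit
    (h : Literature.AlgebraicGeometry.Resolution.CossartPiltant2019AffineOneBlowup.{0})
    (hP : Literature.AlgebraicGeometry.Resolution.CossartPiltant2019Principalization.{0}) (p : ℕ)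
    (h3 : ∀ (K : Type) [Field K] [CharP K p] (A : Type) [CommRing A] [IsDomain A] [Algebra K A]
    [Algebra.FiniteType K A], ringKrullDim A <
    ((3 : ℕ) : WithBot ℕ∞) → ∃ I : Ideal A, I ≠ ⊥
      ∧ Literature.AlgebraicGeometry.Resolution.Scheme.IsRegular
    (Literature.AlgebraicGeometry.Resolution.affineBlowup I)
      ∧ ∀ 𝔭 : PrimeSpectrum A, I ≤ 𝔭.asIdeal ↔ ¬ IsRegularLocalRing
    (Localization.AtPrime 𝔭.asIdeal)) (K : Type) [Field K] [CharP K p] (A : Type) [CommRing A]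
    [IsDomain A] [Algebra K A] [Algebra.FiniteType K A] (hA : ringKrullDim A <
    ((3 + 1 : ℕ) : WithBot ℕ∞)) : ∃ I : Ideal A, I ≠ ⊥
      ∧ Literature.AlgebraicGeometry.Resolution.Scheme.IsRegular
    (Literature.AlgebraicGeometry.Resolution.affineBlowup I)
      ∧ ∀ 𝔭 : PrimeSpectrum A, I ≤ 𝔭.asIdeal ↔ ¬ IsRegularLocalRing
    (Localization.AtPrime 𝔭.asIdeal) :=
  oneShot_level_four_of_facts h hP p h3 K A hA

end Summit.ResolutionOfSingularities.ResolutionOfSingularities.Theorems.SectionAscent.TraceIdeal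

end
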